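import Literature.Analysis.FluidPDE.StokesTorusFrameEquivalence
import Literature.Analysis.FunctionSpaces.TorusEnstrophyPeterPaul
import Literature.Analysis.FluidPDE.NSStrongSolutions2D
import HarnessLib

/-!
# The frame norm identity `‖y‖² = ‖S y‖²_{L²} + ‖∇(S y)‖²_{L²}` for `S = (1 + A)^{-1/2}` on the energy
# space of the flat torus

Analysis/FluidPDE support file (everything proved; no definitions, no named facts), completing
`StokesTorusFrameBound.lean` and `StokesTorusFrameEquivalence.lean` (the two-sided bound with a factor `2`).  Let `b` be a Hilbert basis of the energy space `H = Torus.energySpace d`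
consisting of Stokes modes `Torus.stokesModeL2 k a c` with symbol `m i = 4π²|kᵢ|²`, and let
`S : H →L[ℝ] H` act diagonally, `S (b i) = (1 + m i)^{-1/2} b i` — the frame operator `(1 + A)^{-1/2}`
of the Stokes operator `A` (Constantin–Foias 1988, Ch. 4, (4.4)–(4.7), (4.11)–(4.13): `V = D(A^{1/2})`,
`‖v‖²_V = ‖v‖² + ‖A^{1/2} v‖²`, and `(1 + A)^{-1/2} : H → V` is an isometry for this norm).  The tree's
frame bound `Torus.tsum_one_add_stokesEigenvalue_mul_enorm_sq_le` is the inequality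
`‖S y‖² + ‖∇(S y)‖₂² ≤ ‖y‖²`; here we prove the IDENTITY

  `‖y‖² = ‖S y‖² + ‖∇(S y)‖₂²`       (`Torus.norm_sq_eq_norm_sq_add_eGradNormSq_frame`),

with `‖∇ ·‖₂² = Torus.eGradNormSq` the spectral enstrophy of the `L²` class `S y` (finite,
`Torus.eGradNormSq_frame_le`).  Consequently convergence in `H` of frame PREIMAGES is convergence of the
frame images in `L²` together with convergence of the enstrophy of the difference — the form in which the
`V`-continuity of linearised Navier–Stokes trajectories from `V`-data is read in the frame of the mild
formulation (Constantin–Foias 1988, Ch. 14).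

## Proof

* `Torus.IsStokesImage.eGradNormSq_eq_ofReal_inner` — for a Stokes pair `w = −Δv` in `H`,
  `‖∇v‖₂² = ⟪w, v⟫` (Parseval, `ŵ(k) = 4π²|k|² v̂(k)`);
* `Torus.tsum_one_add_stokesEigenvalue_mul_enorm_sq_eq_add` (`StokesTorusFrameEquivalence.lean`) — the
  weighted coefficient sum of the frame bound splits as `∑ₖ (1 + 4π²|k|²)‖û(k)‖² = ‖u‖² + ‖∇u‖₂²`, whence
  `‖S y‖² + ‖∇(S y)‖₂² ≤ ‖y‖²`;
* for the truncations `y_F = ∑_{i ∈ F} ⟪bᵢ, y⟫ bᵢ` the identity is a finite computation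
  (`Torus.norm_sq_sum_eq_frame`: `S y_F` and `∑ mᵢ (1 + mᵢ)^{-1/2} ⟪bᵢ, y⟫ bᵢ` form a Stokes pair,
  `Torus.isStokesImage_sum_smul`), and `y_F → y`; the enstrophy of `S y_F` is controlled from above by
  the Peter–Paul inequality `Torus.eGradNormSq_le_add_mul_eGradNormSq_sub`
  (`‖∇S y_F‖₂² ≤ (1 + δ)‖∇S y‖₂² + (1 + δ⁻¹)‖∇S(y_F − y)‖₂²`, the last term `≤ (1 + δ⁻¹)‖y_F − y‖²` by the
  frame bound), so `‖y‖² ≤ ‖S y‖² + (1 + δ)‖∇(S y)‖₂²` for every `δ > 0`.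

## References

* P. Constantin, C. Foias, *Navier–Stokes Equations*, Univ. Chicago Press (1988), Ch. 4,
  (4.4)–(4.7), (4.11)–(4.13), (4.33)–(4.37); Ch. 14. [ConstantinFoiasNSE1988]
-/

noncomputable section

open MeasureTheory Filter UnitAddTorus
open scoped InnerProductSpace RealInnerProductSpace ENNReal Topology

namespace Literature.Analysis.FluidPDE

namespace Torus

variable {d : Type*} [Fintype d] [DecidableEq d]

/-! ### The enstrophy of a Stokes pair and the splitting of the weighted coefficient sum -/

/-- **The enstrophy of a Stokes pair**: if `v, w ∈ H` with `w = −Δv` weakly (`Torus.IsStokesImage`), then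
`‖∇v‖₂² = ⟪w, v⟫` in `[0, ∞]` (Parseval `⟪w, v⟫ = ∑ₖ Re⟪ŵ(k), v̂(k)⟫` and `ŵ(k) = 4π²|k|² v̂(k)`;
Constantin–Foias 1988, Ch. 4, (4.4), (4.37): `(Au, u) = ∑ₖ 4π²|k|²|uₖ|²`). [folklore] -/
theorem IsStokesImage.eGradNormSq_eq_ofReal_inner
    {v w : Lp (EuclideanSpace ℝ d) 2 (volume : Measure (UnitAddTorus d))}
    (hv : v ∈ FunctionSpaces.Torus.energySpace d) (hw : w ∈ FunctionSpaces.Torus.energySpace d)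
    (h : IsStokesImage v w) :
    FunctionSpaces.Torus.eGradNormSq (v : UnitAddTorus d → EuclideanSpace ℝ d) = ENNReal.ofReal ⟪w, v⟫_ℝ := by
  set cv : (d → ℤ) → EuclideanSpace ℂ d := fun k =>
    mFourierCoeff (FunctionSpaces.EuclideanSpace.complexify ∘ (v : UnitAddTorus d → EuclideanSpace ℝ d)) k
    with hcv
  -- Parseval for `⟪w, v⟫` (adapted from `tsum_one_add_stokesEigenvalue_mul_enorm_sq_eq`)
  have h2 : HasSum (fun k : d → ℤ => stokesEigenvalue k * ‖cv k‖ ^ 2) ⟪w, v⟫_ℝ := by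
    have h' := hasSum_re_inner_mFourierCoeff_inner w v
    convert h' using 1
    funext k
    rw [h.mFourierCoeff_eq hv hw k, inner_smul_left, Complex.conj_ofReal, inner_self_eq_norm_sq_to_K,
      Complex.re_ofReal_mul]
    norm_cast
  have hnn : ∀ k : d → ℤ, 0 ≤ stokesEigenvalue k * ‖cv k‖ ^ 2 := fun k =>
    mul_nonneg (stokesEigenvalue_nonneg k) (sq_nonneg _)
  rw [FunctionSpaces.Torus.eGradNormSq_eq_tsum, ← ENNReal.tsum_mul_left, ← h2.tsum_eq,
    ENNReal.ofReal_tsum_of_nonneg hnn h2.summable]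
  refine tsum_congr fun k => ?_
  rw [← mul_assoc, ← ENNReal.ofReal_mul (by positivity), ENNReal.ofReal_mul (stokesEigenvalue_nonneg k),
    ← ofReal_norm, ENNReal.ofReal_pow (norm_nonneg _)]
  rfl

/-! ### The frame: enstrophy bound and the finite-dimensional identity -/

section Frame

variable {ι : Type*} (b : HilbertBasis ι ℝ (FunctionSpaces.Torus.energySpace d)) (m : ι → ℝ)
  (hb : ∀ i, ∃ (k : d → ℤ) (a : EuclideanSpace ℝ d) (c : Bool),
    ((b i : FunctionSpaces.Torus.energySpace d) :
        Lp (EuclideanSpace ℝ d) 2 (volume : Measure (UnitAddTorus d))) = stokesModeL2 k a c ∧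
      m i = stokesEigenvalue k)
  (S : FunctionSpaces.Torus.energySpace d →L[ℝ] FunctionSpaces.Torus.energySpace d)
  (hS : ∀ i, S (b i) = ((1 + m i) ^ (-(1 / 2 : ℝ))) • b i)

include hb hS

/-- **The frame operator maps `H` into finite enstrophy**: `‖∇(S y)‖₂² ≤ ‖y‖²` for every `y ∈ H` — the
enstrophy part of the frame bound `∑ₖ (1 + 4π²|k|²) ‖𝓕(S y)(k)‖² ≤ ‖y‖²`
(`Torus.tsum_one_add_stokesEigenvalue_mul_enorm_sq_le`; Constantin–Foias 1988, Ch. 4, (4.11)–(4.13)).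
[cite: ConstantinFoiasNSE1988, Ch. 4 (4.11)–(4.13)] -/
theorem eGradNormSq_frame_le (y : FunctionSpaces.Torus.energySpace d) :
    FunctionSpaces.Torus.eGradNormSq (((S y : FunctionSpaces.Torus.energySpace d) :
        Lp (EuclideanSpace ℝ d) 2 (volume : Measure (UnitAddTorus d))) : UnitAddTorus d → EuclideanSpace ℝ d) ≤
      ENNReal.ofReal (‖y‖ ^ 2) := by
  refine le_trans ?_ (tsum_one_add_stokesEigenvalue_mul_enorm_sq_le b m hb S hS y)
  rw [tsum_one_add_stokesEigenvalue_mul_enorm_sq_eq_add]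
  exact le_add_self

/-- **The frame norm identity on finite combinations of the basis**: for `y_F = ∑_{i ∈ F} cᵢ bᵢ`,
`‖y_F‖² = ‖S y_F‖² + ‖∇(S y_F)‖₂²`: `S y_F = ∑ (1 + mᵢ)^{-1/2} cᵢ bᵢ` and `∑ mᵢ (1 + mᵢ)^{-1/2} cᵢ bᵢ` form a
Stokes pair (`Torus.isStokesImage_sum_smul`), whose enstrophy is their inner product
(`Torus.IsStokesImage.eGradNormSq_eq_ofReal_inner`), and `∑ (1 + mᵢ) (1 + mᵢ)^{-1} cᵢ² = ∑ cᵢ²`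
(Constantin–Foias 1988, Ch. 4, (4.37)). [folklore] -/
theorem norm_sq_sum_eq_frame (c : ι → ℝ) (F : Finset ι) :
    ‖∑ i ∈ F, c i • b i‖ ^ 2 = ‖S (∑ i ∈ F, c i • b i)‖ ^ 2 +
      (FunctionSpaces.Torus.eGradNormSq (((S (∑ i ∈ F, c i • b i) : FunctionSpaces.Torus.energySpace d) :
        Lp (EuclideanSpace ℝ d) 2 (volume : Measure (UnitAddTorus d))) :
          UnitAddTorus d → EuclideanSpace ℝ d)).toReal := by
  classical
  have hm0 : ∀ i, 0 ≤ m i := fun i => by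
    obtain ⟨k, a, c', -, hmi⟩ := hb i
    rw [hmi]
    exact stokesEigenvalue_nonneg k
  set σ : ι → ℝ := fun i => (1 + m i) ^ (-(1 / 2 : ℝ)) with hσ
  have hσsq : ∀ i, (1 + m i) * σ i ^ 2 = 1 := fun i => by
    have h1 : 0 < 1 + m i := by linarith [hm0 i]
    rw [hσ]
    dsimp only
    rw [← Real.rpow_natCast, ← Real.rpow_mul h1.le]
    norm_num
    rw [Real.rpow_neg_one, mul_inv_cancel₀ h1.ne']
  -- `S y_F = v_F := ∑ (c i σ i) • b i`, with Stokes image `w_F := ∑ (m i c i σ i) • b i`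
  set cS : ι → ℝ := fun i => c i * σ i with hcS
  set vF : FunctionSpaces.Torus.energySpace d := ∑ i ∈ F, cS i • b i with hvF
  set wF : FunctionSpaces.Torus.energySpace d := ∑ i ∈ F, (m i * cS i) • b i with hwF
  have hSv : S (∑ i ∈ F, c i • b i) = vF := by
    rw [map_sum]
    refine Finset.sum_congr rfl fun i _ => ?_
    rw [map_smul, hS i, smul_smul]
  have hgraph := isStokesImage_sum_smul b m hb cS F
  have hE := IsStokesImage.eGradNormSq_eq_ofReal_inner vF.2 wF.2 hgraph
  -- the three finite sums
  have hn0 : ‖∑ i ∈ F, c i • b i‖ ^ 2 = ∑ i ∈ F, c i * c i := by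
    rw [← real_inner_self_eq_norm_sq, b.orthonormal.inner_sum]
    simp
  have hn : ‖vF‖ ^ 2 = ∑ i ∈ F, cS i * cS i := by
    rw [← real_inner_self_eq_norm_sq, hvF, b.orthonormal.inner_sum]
    simp
  have hi : ⟪((wF : FunctionSpaces.Torus.energySpace d) :
        Lp (EuclideanSpace ℝ d) 2 (volume : Measure (UnitAddTorus d))),
      ((vF : FunctionSpaces.Torus.energySpace d) :
        Lp (EuclideanSpace ℝ d) 2 (volume : Measure (UnitAddTorus d)))⟫_ℝ = ∑ i ∈ F, m i * cS i * cS i := by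
    rw [← Submodule.coe_inner, hwF, hvF, b.orthonormal.inner_sum]
    simp
  have hipos : 0 ≤ ∑ i ∈ F, m i * cS i * cS i :=
    Finset.sum_nonneg fun i _ => by nlinarith [hm0 i, sq_nonneg (cS i)]
  rw [hSv, hE, hi, ENNReal.toReal_ofReal hipos, hn0, hn, ← Finset.sum_add_distrib]
  refine Finset.sum_congr rfl fun i _ => ?_
  have := hσsq i
  calc c i * c i = ((1 + m i) * σ i ^ 2) * (c i * c i) := by rw [this, one_mul]
    _ = cS i * cS i + m i * cS i * cS i := by simp only [hcS]; ring

/-! ### The frame norm identity -/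

/-- **The frame norm identity `‖y‖² = ‖S y‖² + ‖∇(S y)‖₂²`** for the frame operator `S = (1 + A)^{-1/2}`
pinned on a Hilbert basis of Stokes modes (`S (b i) = (1 + m i)^{-1/2} b i`) and every `y` in the energy
space `H` of the flat torus: `(1 + A)^{-1/2}` is an isometry of `H` onto `V = D(A^{1/2})` normed by
`‖v‖²_V = ‖v‖² + ‖∇v‖₂²` (Constantin–Foias 1988, Ch. 4, (4.4)–(4.7), (4.11)–(4.13), (4.37)).  Proof: `≥` is
the frame bound `Torus.tsum_one_add_stokesEigenvalue_mul_enorm_sq_le` split by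
`Torus.tsum_one_add_stokesEigenvalue_mul_enorm_sq_eq_add`; for `≤`, the identity holds for the truncations
`y_F = ∑_{i ∈ F} ⟪bᵢ, y⟫ bᵢ → y` (`Torus.norm_sq_sum_eq_frame`), and
`‖∇S y_F‖₂² ≤ (1 + δ)‖∇S y‖₂² + (1 + δ⁻¹)‖y_F − y‖²` (Peter–Paul for the enstrophy and the frame bound applied
to `y_F − y`), so that in the limit `‖y‖² ≤ ‖S y‖² + (1 + δ)‖∇(S y)‖₂²` for every `δ > 0`.
[cite: ConstantinFoiasNSE1988, Ch. 4 (4.4)–(4.7), (4.11)–(4.13)] -/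
theorem norm_sq_eq_norm_sq_add_eGradNormSq_frame (y : FunctionSpaces.Torus.energySpace d) :
    ‖y‖ ^ 2 = ‖S y‖ ^ 2 +
      (FunctionSpaces.Torus.eGradNormSq (((S y : FunctionSpaces.Torus.energySpace d) :
        Lp (EuclideanSpace ℝ d) 2 (volume : Measure (UnitAddTorus d))) :
          UnitAddTorus d → EuclideanSpace ℝ d)).toReal := by
  classical
  -- notation: the enstrophy of the frame image, finite by the frame bound
  set E : FunctionSpaces.Torus.energySpace d → ℝ≥0∞ := fun z =>
    FunctionSpaces.Torus.eGradNormSq (((S z : FunctionSpaces.Torus.energySpace d) :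
      Lp (EuclideanSpace ℝ d) 2 (volume : Measure (UnitAddTorus d))) : UnitAddTorus d → EuclideanSpace ℝ d)
    with hEdef
  have hEle : ∀ z, E z ≤ ENNReal.ofReal (‖z‖ ^ 2) := fun z => eGradNormSq_frame_le b m hb S hS z
  have hEfin : ∀ z, E z ≠ ⊤ := fun z => ne_top_of_le_ne_top ENNReal.ofReal_ne_top (hEle z)
  refine le_antisymm ?_ ?_
  · -- `≤`: truncations, Peter–Paul, and the limits `F → ∞`, `δ → 0⁺`
    set yF : Finset ι → FunctionSpaces.Torus.energySpace d := fun F => ∑ i ∈ F, b.repr y i • b i with hyF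
    have htend : Tendsto yF atTop (𝓝 y) := b.hasSum_repr y
    have hfin : ∀ F, ‖yF F‖ ^ 2 = ‖S (yF F)‖ ^ 2 + (E (yF F)).toReal := fun F =>
      norm_sq_sum_eq_frame b m hb S hS (fun i => b.repr y i) F
    -- Peter–Paul: `E y_F ≤ (1 + δ) E y + (1 + δ⁻¹) ‖y_F − y‖²`
    have hPP : ∀ δ : ℝ, 0 < δ → ∀ F,
        (E (yF F)).toReal ≤ (1 + δ) * (E y).toReal + (1 + δ⁻¹) * ‖yF F - y‖ ^ 2 := by
      intro δ hδ F
      have hint : ∀ z : FunctionSpaces.Torus.energySpace d, Integrable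
          (((S z : FunctionSpaces.Torus.energySpace d) : Lp (EuclideanSpace ℝ d) 2 (volume : Measure (UnitAddTorus d))) :
            UnitAddTorus d → EuclideanSpace ℝ d) volume := fun z => (Lp.memLp _).integrable one_le_two
      have h := FunctionSpaces.Torus.eGradNormSq_le_add_mul_eGradNormSq_sub (hint (yF F)) (hint y) hδ
      -- the enstrophy of the difference is that of the frame image of `y_F − y`, `≤ ‖y_F − y‖²`
      have hsub : FunctionSpaces.Torus.eGradNormSq
          ((((S (yF F) : FunctionSpaces.Torus.energySpace d) : Lp (EuclideanSpace ℝ d) 2 (volume : Measure (UnitAddTorus d))) :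
            UnitAddTorus d → EuclideanSpace ℝ d) -
          (((S y : FunctionSpaces.Torus.energySpace d) : Lp (EuclideanSpace ℝ d) 2 (volume : Measure (UnitAddTorus d))) :
            UnitAddTorus d → EuclideanSpace ℝ d)) = E (yF F - y) := by
        simp only [hEdef, map_sub, Submodule.coe_sub]
        exact (eGradNormSq_congr_ae (Lp.coeFn_sub _ _)).symm
      rw [hsub] at h
      have h' : E (yF F) ≤ ENNReal.ofReal (1 + δ) * E y + ENNReal.ofReal (1 + δ⁻¹) * ENNReal.ofReal (‖yF F - y‖ ^ 2) :=
        h.trans (by gcongr; exact hEle _)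
      have hne : ENNReal.ofReal (1 + δ) * E y + ENNReal.ofReal (1 + δ⁻¹) * ENNReal.ofReal (‖yF F - y‖ ^ 2) ≠ ⊤ :=
        ENNReal.add_ne_top.2 ⟨ENNReal.mul_ne_top ENNReal.ofReal_ne_top (hEfin y),
          ENNReal.mul_ne_top ENNReal.ofReal_ne_top ENNReal.ofReal_ne_top⟩
      have h'' := ENNReal.toReal_mono hne h'
      rwa [ENNReal.toReal_add (ENNReal.mul_ne_top ENNReal.ofReal_ne_top (hEfin y))
        (ENNReal.mul_ne_top ENNReal.ofReal_ne_top ENNReal.ofReal_ne_top), ENNReal.toReal_mul,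
        ENNReal.toReal_mul, ENNReal.toReal_ofReal (by positivity), ENNReal.toReal_ofReal (by positivity),
        ENNReal.toReal_ofReal (sq_nonneg _)] at h''
    -- the limit `F → ∞` at fixed `δ > 0`
    have hδlim : ∀ δ : ℝ, 0 < δ → ‖y‖ ^ 2 ≤ ‖S y‖ ^ 2 + (1 + δ) * (E y).toReal := by
      intro δ hδ
      have hl : Tendsto (fun F => ‖yF F‖ ^ 2) atTop (𝓝 (‖y‖ ^ 2)) := (htend.norm).pow 2
      have hr : Tendsto (fun F => ‖S (yF F)‖ ^ 2 + (1 + δ) * (E y).toReal + (1 + δ⁻¹) * ‖yF F - y‖ ^ 2) atTop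
          (𝓝 (‖S y‖ ^ 2 + (1 + δ) * (E y).toReal + (1 + δ⁻¹) * 0 ^ 2)) := by
        have h1 : Tendsto (fun F => ‖S (yF F)‖ ^ 2) atTop (𝓝 (‖S y‖ ^ 2)) :=
          (((S.continuous.tendsto y).comp htend).norm).pow 2
        have h2 : Tendsto (fun F => ‖yF F - y‖) atTop (𝓝 0) := tendsto_iff_norm_sub_tendsto_zero.1 htend
        exact (h1.add tendsto_const_nhds).add ((h2.pow 2).const_mul _)
      rw [zero_pow two_ne_zero, mul_zero, add_zero] at hr
      refine le_of_tendsto_of_tendsto' hl hr fun F => ?_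
      rw [hfin F, add_assoc]
      gcongr
      exact hPP δ hδ F
    -- the limit `δ → 0⁺`
    have hδt : Tendsto (fun δ : ℝ => ‖S y‖ ^ 2 + (1 + δ) * (E y).toReal) (𝓝[>] 0)
        (𝓝 (‖S y‖ ^ 2 + (1 + 0) * (E y).toReal)) :=
      ((tendsto_const_nhds.add (tendsto_id.mono_left nhdsWithin_le_nhds)).mul_const _).const_add _
    rw [add_zero, one_mul] at hδt
    exact ge_of_tendsto hδt (mem_of_superset self_mem_nhdsWithin fun δ hδ => hδlim δ hδ)
  · -- `≥`: the frame bound, split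
    have h := tsum_one_add_stokesEigenvalue_mul_enorm_sq_le b m hb S hS y
    rw [tsum_one_add_stokesEigenvalue_mul_enorm_sq_eq_add] at h
    have h' := ENNReal.toReal_mono ENNReal.ofReal_ne_top h
    rwa [ENNReal.toReal_add ENNReal.ofReal_ne_top (hEfin y), ENNReal.toReal_ofReal (sq_nonneg _),
      ENNReal.toReal_ofReal (sq_nonneg _)] at h'

/-- **Frame-norm convergence from `V`-convergence of the frame images**: for `z, y ∈ H`,
`‖z − y‖² = ‖S z − S y‖² + ‖∇(S z − S y)‖₂²` (the identity applied to `z − y`), so a net of frame preimages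
converges in `H` as soon as the frame images converge in `L²` and the enstrophy of the differences tends to
zero (Constantin–Foias 1988, Ch. 4, (4.11)–(4.13)). [folklore] -/
theorem norm_sub_sq_eq_frame (z y : FunctionSpaces.Torus.energySpace d) :
    ‖z - y‖ ^ 2 = ‖S z - S y‖ ^ 2 +
      (FunctionSpaces.Torus.eGradNormSq
        ((((S z : FunctionSpaces.Torus.energySpace d) : Lp (EuclideanSpace ℝ d) 2 (volume : Measure (UnitAddTorus d))) :
            UnitAddTorus d → EuclideanSpace ℝ d) -
          (((S y : FunctionSpaces.Torus.energySpace d) : Lp (EuclideanSpace ℝ d) 2 (volume : Measure (UnitAddTorus d))) :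
            UnitAddTorus d → EuclideanSpace ℝ d))).toReal := by
  rw [norm_sq_eq_norm_sq_add_eGradNormSq_frame b m hb S hS (z - y), map_sub]
  congr 2
  rw [Submodule.coe_sub]
  exact eGradNormSq_congr_ae (Lp.coeFn_sub _ _)

end Frame

end Torus

end Literature.Analysis.FluidPDE

end
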